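import Mathlib

/-!
# Stub `stub_subseqLocUnif` of line `Sketch` for crux `TameOrBrodyR4` (stmt-SmoothPoincare4-7826, route SullivanDual)

Arzelà–Ascoli with moving discs: maps `g n : ℂ → ℝ⁴` with `‖d(g n)‖ ≤ 2` and values in a fixed
compact `K` on the discs `‖z‖ ≤ r n`, `r n → ∞`, have a subsequence converging locally uniformly
on `ℂ`. Proof (direct, metric):

* the derivative bound gives the Lipschitz estimate `dist (g n z) (g n w) ≤ 2 * dist z w` on the
  disc `‖·‖ ≤ r n` (mean value inequality on a convex set, `SubseqLocUnif.dist_le_of_fderiv`);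
* diagonal subsequence: for a dense sequence `d : ℕ → ℂ` the sequence `n ↦ (m ↦ g n (d m))`
  (patched to `0` off the disc) lives in the compact countable product `Π m, insert 0 K`, hence has
  a convergent subsequence `φ`, i.e. `k ↦ g (φ k) (d m)` converges for every `m`
  (`SubseqLocUnif.exists_subseq_tendsto_on_seq`);
* `ε / 3` argument: on every unit ball the subsequence is uniformly Cauchy (cover the closed ball by
  finitely many `ε / 8`-balls centred at points `d m`, `SubseqLocUnif.uniformCauchySeqOn_ball`);
  completeness of `ℝ⁴` gives the pointwise limit `v` and uniform convergence on unit balls, hence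
  locally uniform convergence.

Folklore (Arzelà 1895 / Ascoli 1884; e.g. Hummel 1997 App. B Prop. B.3).
-/

open scoped ContDiff Topology
open Filter Set Metric

-- the registered namespace `Summit.SmoothPoincare4.SmoothPoincare4.…` repeats a component
set_option linter.dupNamespace false

namespace Summit.SmoothPoincare4.SmoothPoincare4.Cruxes.TameOrBrodyR4.Sketch

/-- Local name for `ℝ⁴` (the registered signature of the stub is spelled with it). -/
local notation "E4" => EuclideanSpace ℝ (Fin 4)

namespace SubseqLocUnif

/-- Mean value inequality on the disc `‖·‖ ≤ R`: a derivative bound `‖df‖ ≤ 2` makes `f`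
`2`-Lipschitz there. -/
theorem dist_le_of_fderiv {f : ℂ → E4} {R : ℝ} (hf : Differentiable ℝ f)
    (hfd : ∀ z : ℂ, ‖z‖ ≤ R → ‖fderiv ℝ f z‖ ≤ 2) {z w : ℂ} (hz : ‖z‖ ≤ R) (hw : ‖w‖ ≤ R) :
    dist (f z) (f w) ≤ 2 * dist z w := by
  rw [dist_eq_norm, dist_eq_norm]
  exact (convex_closedBall (0 : ℂ) R).norm_image_sub_le_of_norm_fderiv_le (𝕜 := ℝ)
    (fun x _ => hf x) (fun x hx => hfd x (mem_closedBall_zero_iff.mp hx))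
    (mem_closedBall_zero_iff.mpr hw) (mem_closedBall_zero_iff.mpr hz)

/-- Diagonal subsequence (compactness of the countable product `Π m, insert 0 K`): along a
subsequence `φ`, the values `g (φ k) (d m)` converge for every `m`. -/
theorem exists_subseq_tendsto_on_seq (K : Set E4) (hK : IsCompact K)
    (g : ℕ → ℂ → E4) (r : ℕ → ℝ) (hr : Tendsto r atTop atTop)
    (hgK : ∀ n (z : ℂ), ‖z‖ ≤ r n → g n z ∈ K) (d : ℕ → ℂ) :
    ∃ (a : ℕ → E4) (φ : ℕ → ℕ), StrictMono φ ∧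
      ∀ m, Tendsto (fun k => g (φ k) (d m)) atTop (𝓝 (a m)) := by
  classical
  set X : ℕ → ℕ → E4 :=
    fun n m => if ‖d m‖ ≤ r n then g n (d m) else 0 with hX
  have hXK : ∀ n, X n ∈ Set.pi univ fun _ : ℕ => insert (0 : E4) K := by
    intro n m _
    by_cases h : ‖d m‖ ≤ r n
    · simp only [hX, if_pos h]
      exact mem_insert_of_mem _ (hgK n _ h)
    · simp only [hX, if_neg h]
      exact mem_insert _ _
  obtain ⟨a, -, φ, hφ, hlim⟩ := (isCompact_univ_pi fun _ : ℕ => hK.insert 0).tendsto_subseq hXK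
  refine ⟨a, φ, hφ, fun m => ?_⟩
  have hm : Tendsto (fun k => (X ∘ φ) k m) atTop (𝓝 (a m)) := tendsto_pi_nhds.mp hlim m
  refine hm.congr' ?_
  filter_upwards [(hr.comp hφ.tendsto_atTop).eventually_ge_atTop ‖d m‖] with k hk
  have hk' : ‖d m‖ ≤ r (φ k) := hk
  simp only [Function.comp_apply, hX, if_pos hk']

/-- The `ε / 3` argument: maps `G k` that are `2`-Lipschitz on discs `‖·‖ ≤ R k`, `R k → ∞`, and
whose values at the points of a dense sequence `d` form Cauchy sequences, are uniformly Cauchy on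
every unit ball. -/
theorem uniformCauchySeqOn_ball (G : ℕ → ℂ → E4) (R : ℕ → ℝ)
    (hR : Tendsto R atTop atTop)
    (hL : ∀ k (z w : ℂ), ‖z‖ ≤ R k → ‖w‖ ≤ R k → dist (G k z) (G k w) ≤ 2 * dist z w)
    (d : ℕ → ℂ) (hd : DenseRange d) (hC : ∀ m, CauchySeq fun k => G k (d m)) (x : ℂ) :
    UniformCauchySeqOn G atTop (ball x 1) := by
  rw [Metric.uniformCauchySeqOn_iff]
  intro ε hε
  have hε8 : (0 : ℝ) < ε / 8 := by positivity
  -- finite cover of `closedBall x 1` by `ε / 8`-balls centred at points of the dense sequence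
  obtain ⟨S, hS⟩ := (isCompact_closedBall x 1).elim_finite_subcover (fun m => ball (d m) (ε / 8))
    (fun _ => isOpen_ball) fun y _ => by
      obtain ⟨m, hm⟩ := hd.exists_dist_lt y hε8
      exact mem_iUnion.mpr ⟨m, mem_ball.mpr hm⟩
  -- finitely many Cauchy conditions and the radius condition, eventually in the threshold `N`
  have h1 : ∀ᶠ N in atTop, ∀ m ∈ S, ∀ p ≥ N, ∀ q ≥ N, dist (G p (d m)) (G q (d m)) < ε / 4 := by
    refine S.eventually_all.mpr fun m _ => ?_
    obtain ⟨N, hN⟩ := Metric.cauchySeq_iff.mp (hC m) (ε / 4) (by positivity)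
    exact eventually_atTop.mpr ⟨N, fun N' hN' p hp q hq => hN p (hN'.trans hp) q (hN'.trans hq)⟩
  have h2 : ∀ᶠ N in atTop, ∀ p ≥ N, ‖x‖ + 1 + ε / 8 ≤ R p := by
    obtain ⟨N, hN⟩ := eventually_atTop.mp (hR.eventually_ge_atTop (‖x‖ + 1 + ε / 8))
    exact eventually_atTop.mpr ⟨N, fun N' hN' p hp => hN p (hN'.trans hp)⟩
  obtain ⟨N, hN1, hN2⟩ := (h1.and h2).exists
  refine ⟨N, fun p hp q hq y hy => ?_⟩
  obtain ⟨m, hmS, hym⟩ : ∃ m ∈ S, dist y (d m) < ε / 8 := by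
    simpa only [mem_iUnion₂, mem_ball, exists_prop] using hS (ball_subset_closedBall hy)
  have hy' : ‖y‖ ≤ ‖x‖ + 1 := norm_le_norm_add_const_of_dist_le (le_of_lt (mem_ball.mp hy))
  have hdm : ‖d m‖ ≤ ‖y‖ + ε / 8 :=
    norm_le_norm_add_const_of_dist_le (by rw [dist_comm]; exact hym.le)
  have hyp : ‖y‖ ≤ R p := by linarith [hN2 p hp]
  have hyq : ‖y‖ ≤ R q := by linarith [hN2 q hq]
  have hmp : ‖d m‖ ≤ R p := by linarith [hN2 p hp]
  have hmq : ‖d m‖ ≤ R q := by linarith [hN2 q hq]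
  calc dist (G p y) (G q y)
      ≤ dist (G p y) (G p (d m)) + dist (G p (d m)) (G q (d m)) + dist (G q (d m)) (G q y) :=
        dist_triangle4 _ _ _ _
    _ ≤ 2 * dist y (d m) + ε / 4 + 2 * dist (d m) y := by
        gcongr
        · exact hL p y (d m) hyp hmp
        · exact (hN1 m hmS p hp q hq).le
        · exact hL q (d m) y hmq hyq
    _ < ε := by rw [dist_comm (d m) y]; linarith

end SubseqLocUnif

/-- **Arzelà–Ascoli with moving discs.** `C^∞` maps `g n : ℂ → ℝ⁴` with `‖d(g n)‖ ≤ 2` and values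
in a fixed compact `K` on the discs `‖z‖ ≤ r n`, `r n → ∞`, have a subsequence converging locally
uniformly on `ℂ`. -/
theorem stub_subseqLocUnif (K : Set E4) (hK : IsCompact K) (g : ℕ → ℂ → E4) (r : ℕ → ℝ)
    (hr : Tendsto r atTop atTop) (hg : ∀ n, ContDiff ℝ ∞ (g n))
    (hgK : ∀ n (z : ℂ), ‖z‖ ≤ r n → g n z ∈ K)
    (hgd : ∀ n (z : ℂ), ‖z‖ ≤ r n → ‖fderiv ℝ (g n) z‖ ≤ 2) :
    ∃ (v : ℂ → E4) (φ : ℕ → ℕ), StrictMono φ ∧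
      TendstoLocallyUniformly (fun k => g (φ k)) v atTop := by
  obtain ⟨d, hd⟩ := TopologicalSpace.exists_dense_seq ℂ
  obtain ⟨a, φ, hφ, ha⟩ := SubseqLocUnif.exists_subseq_tendsto_on_seq K hK g r hr hgK d
  have hL : ∀ k (z w : ℂ), ‖z‖ ≤ r (φ k) → ‖w‖ ≤ r (φ k) →
      dist (g (φ k) z) (g (φ k) w) ≤ 2 * dist z w := fun k _ _ hz hw =>
    SubseqLocUnif.dist_le_of_fderiv ((hg _).differentiable (by simp)) (hgd _) hz hw
  have hU : ∀ x, UniformCauchySeqOn (fun k => g (φ k)) atTop (ball x 1) :=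
    SubseqLocUnif.uniformCauchySeqOn_ball _ _ (hr.comp hφ.tendsto_atTop) hL d hd
      fun m => (ha m).cauchySeq
  have hpt : ∀ z, Tendsto (fun k => g (φ k) z) atTop (𝓝 (limUnder atTop fun k => g (φ k) z)) :=
    fun z => ((hU z).cauchySeq (mem_ball_self one_pos)).tendsto_limUnder
  refine ⟨fun z => limUnder atTop fun k => g (φ k) z, φ, hφ, fun u hu x => ?_⟩
  exact ⟨ball x 1, ball_mem_nhds x one_pos,
    (hU x).tendstoUniformlyOn_of_tendsto (fun y _ => hpt y) u hu⟩

end Summit.SmoothPoincare4.SmoothPoincare4.Cruxes.TameOrBrodyR4.Sketch
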